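import Mathlib
import Summits.AtomisticToContinuum.HydrodynamicLimit.Theorems.InformationPercolationEngineKickFairRelEquilibriumMesoDefs
import Summits.AtomisticToContinuum.HydrodynamicLimit.Theorems.InformationPercolationEngineKickFairRelEquilibriumMesoTransferEnum
import Summits.AtomisticToContinuum.HydrodynamicLimit.Theorems.InformationPercolationEngineKickFairRelEquilibriumMesoTransferDomination
import Summits.AtomisticToContinuum.HydrodynamicLimit.Theorems.InformationPercolationEngineKickFairRelEquilibriumMesoTransferSlots
import Summits.AtomisticToContinuum.HydrodynamicLimit.Theorems.InformationPercolationEngineKickFairRelEquilibriumMesoTransferAE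
import Summits.AtomisticToContinuum.HydrodynamicLimit.Theorems.InformationPercolationEngineKickFairRelEquilibriumMesoTransferKey
import Summits.AtomisticToContinuum.HydrodynamicLimit.Theorems.JParityClosureCollisionTightnessDomination
import Literature.MathematicalPhysics.KineticTheory.LocalGibbsConstEquivalence
import Literature.MathematicalPhysics.KineticTheory.EvenStatTruncationBound
import HarnessLib

/-!
# `KickFairRelEquilibriumMeso`, line `Sketch` — glue T, part (d1): helpers and the three conditional transfers on
# a level set of the key

Helper file (`--supports stmt-AtomisticToContinuum-15177`) of the line lead for the registered glue stub
`stub_pinchTransfer` (registered sub-goal here: `transferLevelSet`). Small facts about the vocabulary (`t_N ≤ 1`,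
`rs_N ≤ 1`, measurability of the kinetic energy, `countFn ≥ 0`), the pathwise bounds `Σ_k |Z_k| ≤ 2C·countFn` and
`|fullSum| ≤ 2C·countFn` on the good set (each kick falls in exactly one window: `transferSlots`), `ℝ≥0∞`
cancellation helpers, the exponent bookkeeping `Λ^{N+1} e^{-M(N+1)} ≤ e^{-r(N+1)}`, the split of `∫_A W` at the
level `λ` of the count, and the main lemma `transfers_on_levelSet` (the finite union bound for set integrals is the tree's
`Literature.Analysis.FluidPDE.lintegral_biUnion_finset_le`): the
four-term inequalities of S0′ (data profiles vs `G₁`, hot homogeneous profiles vs `G₁`) on a level set met by a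
configuration of energy `≤ K₀(N+1)` give the three conditional dominations `LG → G₁`, `G₁ → G_{θ₁}`, `G_{θ₁} → G₁`
(`transferDomination`) with the common constant `Λs = exp(ηp (2K₀+3)(N+1))`.
-/

noncomputable section

open MeasureTheory Set Filter Topology
open scoped ENNReal Classical

namespace Summit.AtomisticToContinuum.HydrodynamicLimit.Theorems.KickFairRelEquilibriumMesoLine

open Literature.Analysis.FluidPDE Literature.MathematicalPhysics.KineticTheory
open Summit.AtomisticToContinuum.HydrodynamicLimit.Theorems

variable {σ : ℝ} {N : ℕ}

/-! ## Small facts about the vocabulary -/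

/-- `tN N ≤ 1`. [folklore] -/
theorem tN_le_one (N : ℕ) : tN N ≤ 1 := by
  unfold tN
  exact Real.rpow_le_one_of_one_le_of_nonpos (by linarith [(Nat.cast_nonneg N : (0 : ℝ) ≤ N)]) (by norm_num)

/-- `rs N ≤ 1`. [folklore] -/
theorem rs_le_one (N : ℕ) : rs N ≤ 1 := by
  unfold rs
  exact Real.rpow_le_one_of_one_le_of_nonpos (by linarith [(Nat.cast_nonneg N : (0 : ℝ) ≤ N)]) (by norm_num)

/-- The kinetic energy is a measurable function of the configuration. [folklore] -/
theorem measurable_kinEnergy : Measurable (kinEnergy : Phase N → ℝ) := by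
  unfold kinEnergy
  exact Finset.measurable_sum _ fun i _ => (measurable_pi_apply i).snd.norm.pow_const 2

/-- `countFn ≥ 0`. [folklore] -/
theorem countFn_nonneg (Φ : Flow σ N) (hσ : 0 < σ) (τ : ℝ) (z : Phase N) : 0 ≤ countFn Φ τ z := by
  unfold countFn
  refine mul_nonneg (div_nonneg (hsDiameter_pos hσ N).le (by positivity)) (Finset.sum_nonneg fun i _ => ?_)
  split_ifs <;> positivity

/-- **On the good set, `Σ_{k<m} |Z_k| ≤ 2C · countFn`** for the windows of a partition of `(0, τ]` (each kick falls in
exactly one window: `sum_window_indicator_eq_one` + `transferEnum`), whenever `|g| ≤ C`, `|h| ≤ 1`, `|κ| ≤ C`. [folklore] -/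
theorem sum_abs_slotSum_le_of_kappa_le (Φ : Flow σ N) (hσ : 0 < σ) {τ : ℝ} (hτ : 0 < τ) (r : ℝ)
    {g : V3 × V3 × V3 → ℝ} {C : ℝ} (hg : ∀ p, |g p| ≤ C) {h : Fin (N + 1) → ℕ → Past N → ℝ}
    (hh : ∀ i n p, |h i n p| ≤ 1) {m : ℕ} (hm : 0 < m) {z : Phase N} (hz : z ∈ Φ.good)
    (hκ : ∀ i : Fin (N + 1), ∀ n : ℕ, |kappa Φ r g i n z| ≤ C) :
    ∑ k ∈ Finset.range m, |slotSum Φ τ r (wEnd τ m k) (wEnd τ m (k + 1)) g h z| ≤ 2 * C * countFn Φ τ z := by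
  have hC : 0 ≤ C := (abs_nonneg _).trans (hg 0)
  have hε : 0 ≤ hsDiameter σ N / ((N : ℝ) + 1) := div_nonneg (hsDiameter_pos hσ N).le (by positivity)
  -- bound each |Z_k| by the sum of the absolute values of its summands, then swap the sums
  have hk : ∀ k, |slotSum Φ τ r (wEnd τ m k) (wEnd τ m (k + 1)) g h z| ≤
      hsDiameter σ N / ((N : ℝ) + 1) * ∑ i : Fin (N + 1), ∑ n ∈ Finset.range (cnt Φ τ z i),
        (if wEnd τ m k < Φ.nthCollisionTimeOf i n z ∧ Φ.nthCollisionTimeOf i n z ≤ wEnd τ m (k + 1)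
          then (1 : ℝ) else 0) * (2 * C) := by
    intro k
    unfold slotSum
    rw [abs_mul, abs_of_nonneg hε]
    refine mul_le_mul_of_nonneg_left ?_ hε
    refine (Finset.abs_sum_le_sum_abs _ _).trans (Finset.sum_le_sum fun i _ => ?_)
    refine (Finset.abs_sum_le_sum_abs _ _).trans (Finset.sum_le_sum fun n _ => ?_)
    rw [abs_mul]
    have h1 : |(if wEnd τ m k < Φ.nthCollisionTimeOf i n z ∧ Φ.nthCollisionTimeOf i n z ≤ wEnd τ m (k + 1)
        then (1 : ℝ) else 0)| = (if wEnd τ m k < Φ.nthCollisionTimeOf i n z ∧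
          Φ.nthCollisionTimeOf i n z ≤ wEnd τ m (k + 1) then (1 : ℝ) else 0) := by
      split_ifs <;> simp
    rw [h1]
    refine mul_le_mul_of_nonneg_left ?_ (by split_ifs <;> norm_num)
    rw [abs_mul]
    have h2 : |h i n (past Φ r z i n)| ≤ 1 := hh i n _
    have h3 : |g (kick Φ i n z) - kappa Φ r g i n z| ≤ 2 * C :=
      (abs_sub _ _).trans (by linarith [hg (kick Φ i n z), hκ i n])
    calc |h i n (past Φ r z i n)| * |g (kick Φ i n z) - kappa Φ r g i n z| ≤ 1 * (2 * C) :=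
          mul_le_mul h2 h3 (abs_nonneg _) zero_le_one
      _ = 2 * C := one_mul _
  refine (Finset.sum_le_sum fun k _ => hk k).trans ?_
  rw [← Finset.mul_sum, Finset.sum_comm]
  unfold countFn
  rw [mul_comm (2 * C), mul_assoc]
  refine mul_le_mul_of_nonneg_left ?_ hε
  rw [Finset.sum_mul]
  refine Finset.sum_le_sum fun i _ => ?_
  rw [Finset.sum_comm, if_pos hz]
  calc ∑ n ∈ Finset.range (cnt Φ τ z i), ∑ k ∈ Finset.range m,
        (if wEnd τ m k < Φ.nthCollisionTimeOf i n z ∧ Φ.nthCollisionTimeOf i n z ≤ wEnd τ m (k + 1)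
          then (1 : ℝ) else 0) * (2 * C)
      ≤ ∑ n ∈ Finset.range (cnt Φ τ z i), 2 * C := le_of_eq <| by
        refine Finset.sum_congr rfl fun n hn => ?_
        rw [← Finset.sum_mul, sum_window_indicator_eq_one hτ hm
          (nthCollisionTimeOf_mem_Ioc_of_lt_cnt Φ τ z i (Finset.mem_range.1 hn)), one_mul]
    _ = (cnt Φ τ z i : ℝ) * (2 * C) := by rw [Finset.sum_const, Finset.card_range, nsmul_eq_mul]

/-- **On the good set, `|fullSum| ≤ 2C · countFn`** (same hypotheses). [folklore] -/
theorem abs_fullSum_le_of_kappa_le (Φ : Flow σ N) (hσ : 0 < σ) {τ : ℝ} (hτ : 0 < τ) (r : ℝ)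
    {g : V3 × V3 × V3 → ℝ} {C : ℝ} (hg : ∀ p, |g p| ≤ C) {h : Fin (N + 1) → ℕ → Past N → ℝ}
    (hh : ∀ i n p, |h i n p| ≤ 1) {z : Phase N} (hz : z ∈ Φ.good)
    (hκ : ∀ i : Fin (N + 1), ∀ n : ℕ, |kappa Φ r g i n z| ≤ C) :
    |fullSum Φ τ r g h z| ≤ 2 * C * countFn Φ τ z := by
  rw [fullSum_eq_sum_slotSum Φ hτ r g h Nat.one_pos z]
  exact (Finset.abs_sum_le_sum_abs _ _).trans (sum_abs_slotSum_le_of_kappa_le Φ hσ hτ r hg hh Nat.one_pos hz hκ)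

/-! ## Small `ℝ≥0∞` helpers -/

/-- Chaining two conditional dominations through an intermediate law and cancelling its (finite, non-zero) mass:
from `a·x ≤ Λ·b·y` and `c·y ≤ Λ·a·z` conclude `c·x ≤ Λ·Λ·b·z`. [folklore] -/
theorem chain_cancel {a b c x y z Λ : ℝ≥0∞} (ha0 : a ≠ 0) (hat : a ≠ ⊤)
    (h1 : a * x ≤ Λ * b * y) (h2 : c * y ≤ Λ * a * z) : c * x ≤ Λ * Λ * b * z := by
  have key : a * (c * x) ≤ a * (Λ * Λ * b * z) := by
    calc a * (c * x) = c * (a * x) := by ring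
      _ ≤ c * (Λ * b * y) := mul_le_mul_right h1 _
      _ = Λ * b * (c * y) := by ring
      _ ≤ Λ * b * (Λ * a * z) := mul_le_mul_right h2 _
      _ = a * (Λ * Λ * b * z) := by ring
  exact (ENNReal.mul_le_mul_iff_right ha0 hat).1 key

/-- Cancelling a (finite, non-zero) mass: from `a·x ≤ K·a` conclude `x ≤ K`. [folklore] -/
theorem cancel_mass {a x K : ℝ≥0∞} (ha0 : a ≠ 0) (hat : a ≠ ⊤) (h : a * x ≤ K * a) : x ≤ K := by
  rw [mul_comm K] at h
  exact (ENNReal.mul_le_mul_iff_right ha0 hat).1 h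

/-- `Λ^{N+1} e^{-M(N+1)} ≤ e^{-r(N+1)}` when `log Λ + r ≤ M` (`Λ ≥ 1`). [folklore] -/
theorem pow_mul_exp_neg_le {Λ M r : ℝ} (hΛ : 1 ≤ Λ) (hM : Real.log Λ + r ≤ M) (N : ℕ) :
    Λ ^ (N + 1) * Real.exp (-(M * ((N : ℝ) + 1))) ≤ Real.exp (-(r * ((N : ℝ) + 1))) := by
  have hΛ0 : 0 < Λ := by linarith
  have hpow : Λ ^ (N + 1) = Real.exp (((N : ℝ) + 1) * Real.log Λ) := by
    rw [← Real.exp_log hΛ0, ← Real.exp_nat_mul, Real.log_exp]; push_cast; ring_nf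
  rw [hpow, ← Real.exp_add]
  refine Real.exp_le_exp.2 ?_
  have hN : (0 : ℝ) ≤ (N : ℝ) + 1 := by positivity
  nlinarith [mul_le_mul_of_nonneg_left hM hN]

/-- The split of `∫_A W` at the level `λ` of the count: `∫_A 2C·countFn dν ≤ 2Cλ·ν(A) + 2C ∫_{countFn>λ} countFn dν`. [folklore] -/
theorem setLIntegral_W_le {ν : Measure (Phase N)} (Φ : Flow σ N) (τ : ℝ) {C : ℝ} (lam : ℝ) (hC : 0 ≤ C)
    (hWm : Measurable (countFn Φ τ)) (A : Set (Phase N)) :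
    ∫⁻ z in A, ENNReal.ofReal (2 * C * countFn Φ τ z) ∂ν ≤
      ENNReal.ofReal (2 * C * lam) * ν A +
        ENNReal.ofReal (2 * C) * ∫⁻ z in {z | lam < countFn Φ τ z}, ENNReal.ofReal (countFn Φ τ z) ∂ν := by
  have hS : MeasurableSet {z : Phase N | countFn Φ τ z ≤ lam} := measurableSet_le hWm measurable_const
  rw [← lintegral_inter_add_sdiff _ A hS]
  refine add_le_add ?_ ?_
  · calc ∫⁻ z in A ∩ {z | countFn Φ τ z ≤ lam}, ENNReal.ofReal (2 * C * countFn Φ τ z) ∂ν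
        ≤ ∫⁻ _ in A ∩ {z | countFn Φ τ z ≤ lam}, ENNReal.ofReal (2 * C * lam) ∂ν := by
          refine setLIntegral_mono measurable_const fun z hz => ?_
          exact ENNReal.ofReal_le_ofReal (mul_le_mul_of_nonneg_left hz.2 (by positivity))
      _ = ENNReal.ofReal (2 * C * lam) * ν (A ∩ {z | countFn Φ τ z ≤ lam}) := setLIntegral_const _ _
      _ ≤ ENNReal.ofReal (2 * C * lam) * ν A := by gcongr; exact inter_subset_left
  · calc ∫⁻ z in A \ {z | countFn Φ τ z ≤ lam}, ENNReal.ofReal (2 * C * countFn Φ τ z) ∂ν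
        ≤ ∫⁻ z in {z | lam < countFn Φ τ z}, ENNReal.ofReal (2 * C * countFn Φ τ z) ∂ν := by
          refine lintegral_mono_set fun z hz => ?_
          simp only [Set.mem_sdiff, mem_setOf_eq, not_le] at hz
          exact hz.2
      _ = ∫⁻ z in {z | lam < countFn Φ τ z}, ENNReal.ofReal (2 * C) * ENNReal.ofReal (countFn Φ τ z) ∂ν := by
          refine lintegral_congr fun z => ?_
          rw [← ENNReal.ofReal_mul (by positivity)]
      _ = ENNReal.ofReal (2 * C) * ∫⁻ z in {z | lam < countFn Φ τ z}, ENNReal.ofReal (countFn Φ τ z) ∂ν :=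
          lintegral_const_mul _ hWm.ennreal_ofReal

/-! ## The three conditional transfers on a level set of the key -/

/-- **The three per-level-set dominations** (`μ → ν`, `ν → ν'`, `ν' → ν`) delivered by the four-term inequalities of
S0′ (for the data's profiles against `G₁`, and for the hot homogeneous profiles against `G₁`) on a level set of
bounded energy, with the common constant `Λs = exp(ηp (1 + 2(K₀+1)) (N+1))`. [folklore] -/
theorem transfers_on_levelSet {a₀ θ₀ : T3 → ℝ} {u₀ : T3 → V3} (ha : Continuous a₀) (hθ : Continuous θ₀)
    (hu : Continuous u₀) (ha0 : ∀ x, 0 < a₀ x) (hθ0 : ∀ x, 0 < θ₀ x) {θ₁ : ℝ} (hθ₁ : 0 < θ₁) (Φ : Flow σ N)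
    {ηp K₀ : ℝ} (hηp : 0 < ηp)
    (hS1N : ∀ z z' : Phase N, cellKey (rs N) (rs N) z = cellKey (rs N) (rs N) z' →
      canonicalDensity (Torus.geometry (Fin 3)) (hsDiameter σ N) (N + 1) (localGibbsProfile a₀ u₀ θ₀) z *
        canonicalDensity (Torus.geometry (Fin 3)) (hsDiameter σ N) (N + 1)
          (localGibbsProfile (fun _ => 1) (fun _ => 0) (fun _ => 1)) z' ≤
      Real.exp (ηp * (((N : ℝ) + 1) + kinEnergy z + kinEnergy z')) *
        (canonicalDensity (Torus.geometry (Fin 3)) (hsDiameter σ N) (N + 1) (localGibbsProfile a₀ u₀ θ₀) z' *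
          canonicalDensity (Torus.geometry (Fin 3)) (hsDiameter σ N) (N + 1)
            (localGibbsProfile (fun _ => 1) (fun _ => 0) (fun _ => 1)) z))
    (hS2N : ∀ z z' : Phase N, cellKey (rs N) (rs N) z = cellKey (rs N) (rs N) z' →
      canonicalDensity (Torus.geometry (Fin 3)) (hsDiameter σ N) (N + 1)
          (localGibbsProfile (fun _ => 1) (fun _ => 0) (fun _ => θ₁)) z *
        canonicalDensity (Torus.geometry (Fin 3)) (hsDiameter σ N) (N + 1)
          (localGibbsProfile (fun _ => 1) (fun _ => 0) (fun _ => 1)) z' ≤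
      Real.exp (ηp * (((N : ℝ) + 1) + kinEnergy z + kinEnergy z')) *
        (canonicalDensity (Torus.geometry (Fin 3)) (hsDiameter σ N) (N + 1)
            (localGibbsProfile (fun _ => 1) (fun _ => 0) (fun _ => θ₁)) z' *
          canonicalDensity (Torus.geometry (Fin 3)) (hsDiameter σ N) (N + 1)
            (localGibbsProfile (fun _ => 1) (fun _ => 0) (fun _ => 1)) z))
    {z₀ : Phase N} (hz₀E : kinEnergy z₀ ≤ K₀ * ((N : ℝ) + 1)) {F : Phase N → ℝ≥0∞} (hF : Measurable F) :
    (localGibbsLaw σ (fun _ => 1) (fun _ => 0) (fun _ => 1) N Φ (keyLevel N z₀) *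
        ∫⁻ z in keyLevel N z₀, F z ∂(localGibbsLaw σ a₀ u₀ θ₀ N Φ) ≤
      ENNReal.ofReal (Real.exp (ηp * (1 + 2 * (K₀ + 1)) * ((N : ℝ) + 1))) *
        localGibbsLaw σ a₀ u₀ θ₀ N Φ (keyLevel N z₀) *
        ∫⁻ z in keyLevel N z₀, F z
          ∂(localGibbsLaw σ (fun _ => 1) (fun _ => 0) (fun _ => 1) N Φ)) ∧
    (localGibbsLaw σ (fun _ => 1) (fun _ => 0) (fun _ => θ₁) N Φ (keyLevel N z₀) *
        ∫⁻ z in keyLevel N z₀, F z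
          ∂(localGibbsLaw σ (fun _ => 1) (fun _ => 0) (fun _ => 1) N Φ) ≤
      ENNReal.ofReal (Real.exp (ηp * (1 + 2 * (K₀ + 1)) * ((N : ℝ) + 1))) *
        localGibbsLaw σ (fun _ => 1) (fun _ => 0) (fun _ => 1) N Φ (keyLevel N z₀) *
        ∫⁻ z in keyLevel N z₀, F z
          ∂(localGibbsLaw σ (fun _ => 1) (fun _ => 0) (fun _ => θ₁) N Φ)) ∧
    (localGibbsLaw σ (fun _ => 1) (fun _ => 0) (fun _ => 1) N Φ (keyLevel N z₀) *
        ∫⁻ z in keyLevel N z₀, F z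
          ∂(localGibbsLaw σ (fun _ => 1) (fun _ => 0) (fun _ => θ₁) N Φ) ≤
      ENNReal.ofReal (Real.exp (ηp * (1 + 2 * (K₀ + 1)) * ((N : ℝ) + 1))) *
        localGibbsLaw σ (fun _ => 1) (fun _ => 0) (fun _ => θ₁) N Φ (keyLevel N z₀) *
        ∫⁻ z in keyLevel N z₀, F z
          ∂(localGibbsLaw σ (fun _ => 1) (fun _ => 0) (fun _ => 1) N Φ)) := by
  -- densities and their measurability / nonnegativity
  have hmA : Measurable fun z : Phase N => ENNReal.ofReal (canonicalDensity (Torus.geometry (Fin 3)) (hsDiameter σ N)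
      (N + 1) (localGibbsProfile a₀ u₀ θ₀) z) :=
    (measurable_canonicalDensity _ _ (measurable_localGibbsProfile ha hθ hu)).ennreal_ofReal
  have hm1 : Measurable fun z : Phase N => ENNReal.ofReal (canonicalDensity (Torus.geometry (Fin 3)) (hsDiameter σ N)
      (N + 1) (localGibbsProfile (fun _ => 1) (fun _ => 0) (fun _ => 1)) z) :=
    (measurable_canonicalDensity _ _ (measurable_localGibbsProfile continuous_const continuous_const
      continuous_const)).ennreal_ofReal
  have hmT : Measurable fun z : Phase N => ENNReal.ofReal (canonicalDensity (Torus.geometry (Fin 3)) (hsDiameter σ N)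
      (N + 1) (localGibbsProfile (fun _ => 1) (fun _ => 0) (fun _ => θ₁)) z) :=
    (measurable_canonicalDensity _ _ (measurable_localGibbsProfile continuous_const continuous_const
      continuous_const)).ennreal_ofReal
  have hA0 : ∀ z : Phase N, 0 ≤ canonicalDensity (Torus.geometry (Fin 3)) (hsDiameter σ N) (N + 1)
      (localGibbsProfile a₀ u₀ θ₀) z := fun z =>
    canonicalDensity_nonneg' (localGibbsProfile_nonneg (fun x => (ha0 x).le) (fun x => (hθ0 x).le)) _ _ z
  have h10 : ∀ z : Phase N, 0 ≤ canonicalDensity (Torus.geometry (Fin 3)) (hsDiameter σ N) (N + 1)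
      (localGibbsProfile (fun _ => 1) (fun _ => 0) (fun _ => 1)) z := fun z =>
    canonicalDensity_nonneg' (localGibbsProfile_nonneg (fun _ => zero_le_one) (fun _ => zero_le_one)) _ _ z
  have hT0 : ∀ z : Phase N, 0 ≤ canonicalDensity (Torus.geometry (Fin 3)) (hsDiameter σ N) (N + 1)
      (localGibbsProfile (fun _ => 1) (fun _ => 0) (fun _ => θ₁)) z := fun z =>
    canonicalDensity_nonneg' (localGibbsProfile_nonneg (fun _ => zero_le_one) (fun _ => hθ₁.le)) _ _ z
  -- the laws as `withDensity`
  have hμw : localGibbsLaw σ a₀ u₀ θ₀ N Φ = volume.withDensity (fun z => ENNReal.ofReal (canonicalDensity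
      (Torus.geometry (Fin 3)) (hsDiameter σ N) (N + 1) (localGibbsProfile a₀ u₀ θ₀) z)) := by
    rw [localGibbsLaw_eq]; rfl
  have hνw : localGibbsLaw σ (fun _ => 1) (fun _ => 0) (fun _ => 1) N Φ = volume.withDensity (fun z =>
      ENNReal.ofReal (canonicalDensity (Torus.geometry (Fin 3)) (hsDiameter σ N) (N + 1)
        (localGibbsProfile (fun _ => 1) (fun _ => 0) (fun _ => 1)) z)) := by
    rw [localGibbsLaw_eq]; rfl
  have hν'w : localGibbsLaw σ (fun _ => 1) (fun _ => 0) (fun _ => θ₁) N Φ = volume.withDensity (fun z =>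
      ENNReal.ofReal (canonicalDensity (Torus.geometry (Fin 3)) (hsDiameter σ N) (N + 1)
        (localGibbsProfile (fun _ => 1) (fun _ => 0) (fun _ => θ₁)) z)) := by
    rw [localGibbsLaw_eq]; rfl
  set Bz : Set (Phase N) := keyLevel N z₀ with hBz
  have hBzm : MeasurableSet Bz := measurableSet_keyLevel z₀
  -- energy and exponent bounds on the level set
  have hKE : ∀ z ∈ Bz, kinEnergy z ≤ (K₀ + 1) * ((N : ℝ) + 1) := fun z hz =>
    (kinEnergy_le_of_cellKey_eq (rs_pos N) (mem_keyLevel.1 hz) hz₀E).trans (by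
      have := rs_le_one N
      have hK : 0 ≤ kinEnergy z₀ := Finset.sum_nonneg fun i _ => by positivity
      nlinarith)
  have hexp : ∀ z ∈ Bz, ∀ z' ∈ Bz, Real.exp (ηp * (((N : ℝ) + 1) + kinEnergy z + kinEnergy z')) ≤
      Real.exp (ηp * (1 + 2 * (K₀ + 1)) * ((N : ℝ) + 1)) := by
    intro z hz z' hz'
    refine Real.exp_le_exp.2 ?_
    have := hKE z hz; have := hKE z' hz'
    nlinarith
  have key_eq : ∀ z ∈ Bz, ∀ z' ∈ Bz, cellKey (rs N) (rs N) z = cellKey (rs N) (rs N) z' :=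
    fun z hz z' hz' => (mem_keyLevel.1 hz).trans (mem_keyLevel.1 hz').symm
  set Λs : ℝ := Real.exp (ηp * (1 + 2 * (K₀ + 1)) * ((N : ℝ) + 1)) with hΛs
  -- the three four-term inequalities in `ℝ≥0∞`
  have four : ∀ {p q : Phase N → ℝ}, (∀ z, 0 ≤ p z) → (∀ z, 0 ≤ q z) →
      (∀ z ∈ Bz, ∀ z' ∈ Bz, p z * q z' ≤ Λs * (p z' * q z)) →
      ∀ z ∈ Bz, ∀ z' ∈ Bz, ENNReal.ofReal (p z) * ENNReal.ofReal (q z') ≤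
        ENNReal.ofReal Λs * (ENNReal.ofReal (p z') * ENNReal.ofReal (q z)) := by
    intro p q hp hq hpq z hz z' hz'
    rw [← ENNReal.ofReal_mul (hp _), ← ENNReal.ofReal_mul (hp _), ← ENNReal.ofReal_mul (by positivity)]
    exact ENNReal.ofReal_le_ofReal (hpq z hz z' hz')
  have h4A := four hA0 h10 fun z hz z' hz' => (hS1N z z' (key_eq z hz z' hz')).trans
    (mul_le_mul_of_nonneg_right (hexp z hz z' hz') (mul_nonneg (hA0 _) (h10 _)))
  have h41 := four h10 hT0 fun z hz z' hz' => by
    have := hS2N z' z (key_eq z' hz' z hz)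
    calc _ = _ * _ := mul_comm _ _
      _ ≤ _ := this
      _ ≤ Λs * (_ * _) := mul_le_mul_of_nonneg_right (hexp z' hz' z hz) (mul_nonneg (hT0 _) (h10 _))
      _ = Λs * (_ * _) := by ring
  have h4T := four hT0 h10 fun z hz z' hz' => (hS2N z z' (key_eq z hz z' hz')).trans
    (mul_le_mul_of_nonneg_right (hexp z hz z' hz') (mul_nonneg (hT0 _) (h10 _)))
  refine ⟨?_, ?_, ?_⟩
  · have := withDensity_mul_setLIntegral_le_of_fourTerm volume hmA hm1 hF hBzm h4A
    rwa [← hμw, ← hνw] at this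
  · have := withDensity_mul_setLIntegral_le_of_fourTerm volume hm1 hmT hF hBzm h41
    rwa [← hνw, ← hν'w] at this
  · have := withDensity_mul_setLIntegral_le_of_fourTerm volume hmT hm1 hF hBzm h4T
    rwa [← hν'w, ← hνw] at this

/-- **Registered sub-goal `transferLevelSet` of the glue (T-d1)**: `transfers_on_levelSet` with all binders after the
colon. [folklore] -/
theorem transferLevelSet : ∀ (σ : ℝ) (N : ℕ) (a₀ θ₀ : T3 → ℝ) (u₀ : T3 → V3), Continuous a₀ → Continuous θ₀ →
    Continuous u₀ → (∀ x, 0 < a₀ x) → (∀ x, 0 < θ₀ x) → ∀ (θ₁ : ℝ), 0 < θ₁ → ∀ (Φ : Flow σ N) (ηp K₀ : ℝ), 0 < ηp →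
    (∀ z z' : Phase N, cellKey (rs N) (rs N) z = cellKey (rs N) (rs N) z' →
      canonicalDensity (Torus.geometry (Fin 3)) (hsDiameter σ N) (N + 1) (localGibbsProfile a₀ u₀ θ₀) z *
        canonicalDensity (Torus.geometry (Fin 3)) (hsDiameter σ N) (N + 1)
          (localGibbsProfile (fun _ => 1) (fun _ => 0) (fun _ => 1)) z' ≤
      Real.exp (ηp * (((N : ℝ) + 1) + kinEnergy z + kinEnergy z')) *
        (canonicalDensity (Torus.geometry (Fin 3)) (hsDiameter σ N) (N + 1) (localGibbsProfile a₀ u₀ θ₀) z' *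
          canonicalDensity (Torus.geometry (Fin 3)) (hsDiameter σ N) (N + 1)
            (localGibbsProfile (fun _ => 1) (fun _ => 0) (fun _ => 1)) z)) →
    (∀ z z' : Phase N, cellKey (rs N) (rs N) z = cellKey (rs N) (rs N) z' →
      canonicalDensity (Torus.geometry (Fin 3)) (hsDiameter σ N) (N + 1)
          (localGibbsProfile (fun _ => 1) (fun _ => 0) (fun _ => θ₁)) z *
        canonicalDensity (Torus.geometry (Fin 3)) (hsDiameter σ N) (N + 1)
          (localGibbsProfile (fun _ => 1) (fun _ => 0) (fun _ => 1)) z' ≤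
      Real.exp (ηp * (((N : ℝ) + 1) + kinEnergy z + kinEnergy z')) *
        (canonicalDensity (Torus.geometry (Fin 3)) (hsDiameter σ N) (N + 1)
            (localGibbsProfile (fun _ => 1) (fun _ => 0) (fun _ => θ₁)) z' *
          canonicalDensity (Torus.geometry (Fin 3)) (hsDiameter σ N) (N + 1)
            (localGibbsProfile (fun _ => 1) (fun _ => 0) (fun _ => 1)) z)) →
    ∀ (z₀ : Phase N), kinEnergy z₀ ≤ K₀ * ((N : ℝ) + 1) → ∀ (F : Phase N → ℝ≥0∞), Measurable F →
    (localGibbsLaw σ (fun _ => 1) (fun _ => 0) (fun _ => 1) N Φ (keyLevel N z₀) *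
        ∫⁻ z in keyLevel N z₀, F z ∂(localGibbsLaw σ a₀ u₀ θ₀ N Φ) ≤
      ENNReal.ofReal (Real.exp (ηp * (1 + 2 * (K₀ + 1)) * ((N : ℝ) + 1))) *
        localGibbsLaw σ a₀ u₀ θ₀ N Φ (keyLevel N z₀) *
        ∫⁻ z in keyLevel N z₀, F z ∂(localGibbsLaw σ (fun _ => 1) (fun _ => 0) (fun _ => 1) N Φ)) ∧
    (localGibbsLaw σ (fun _ => 1) (fun _ => 0) (fun _ => θ₁) N Φ (keyLevel N z₀) *
        ∫⁻ z in keyLevel N z₀, F z ∂(localGibbsLaw σ (fun _ => 1) (fun _ => 0) (fun _ => 1) N Φ) ≤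
      ENNReal.ofReal (Real.exp (ηp * (1 + 2 * (K₀ + 1)) * ((N : ℝ) + 1))) *
        localGibbsLaw σ (fun _ => 1) (fun _ => 0) (fun _ => 1) N Φ (keyLevel N z₀) *
        ∫⁻ z in keyLevel N z₀, F z ∂(localGibbsLaw σ (fun _ => 1) (fun _ => 0) (fun _ => θ₁) N Φ)) ∧
    (localGibbsLaw σ (fun _ => 1) (fun _ => 0) (fun _ => 1) N Φ (keyLevel N z₀) *
        ∫⁻ z in keyLevel N z₀, F z ∂(localGibbsLaw σ (fun _ => 1) (fun _ => 0) (fun _ => θ₁) N Φ) ≤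
      ENNReal.ofReal (Real.exp (ηp * (1 + 2 * (K₀ + 1)) * ((N : ℝ) + 1))) *
        localGibbsLaw σ (fun _ => 1) (fun _ => 0) (fun _ => θ₁) N Φ (keyLevel N z₀) *
        ∫⁻ z in keyLevel N z₀, F z ∂(localGibbsLaw σ (fun _ => 1) (fun _ => 0) (fun _ => 1) N Φ)) :=
  fun _ _ _ _ _ ha hθ hu ha0 hθ0 _ hθ₁ Φ _ _ hηp hS1N hS2N _ hz₀E _ hF =>
    transfers_on_levelSet ha hθ hu ha0 hθ0 hθ₁ Φ hηp hS1N hS2N hz₀E hF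

end Summit.AtomisticToContinuum.HydrodynamicLimit.Theorems.KickFairRelEquilibriumMesoLine

end
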